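import Mathlib
import Summits.AtomisticToContinuum.HydrodynamicLimit.Theorems.ImplosionDichotomyDenseExcursionSonicCavityDefsB
import Summits.AtomisticToContinuum.HydrodynamicLimit.Theorems.ImplosionDichotomyDenseExcursionSonicConfinementCharacteristic

/-!
# The slaved (second Levinson) gauge of the mode system: the exact ODE of the p-wave content `D = p − ρ m`,
# its vanishing at the sonic point, and the size of the slaving coefficient on the core
# (crux `DenseExcursion`, line `sonic-cavity-renewal` v6, bricks for the registered helper `sonicSlaving_of_tube`)

Helper file (`--supports stmt-AtomisticToContinuum-12586`, line lead a2, stub-worker W2 for `sonicSlaving_of_tube`).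

In the Levinson form of the mode system (`mode_levinson_form`, `…SonicConfinementCharacteristic`),
`u = e^{−θ} m`, `w = e^{−θ} p` (`p = ŵ + 3ŝ`, `m = ŵ − 3ŝ`, `θ′ = (Λ − b₋₋)/c₋`) satisfy `u′ = α w`, `w′ = q w + β u` with
`α = −b₋₊/c₋`, `β = −b₊₋/c₊`, `q = (Λ − b₊₊)/c₊ − (Λ − b₋₋)/c₋ = Q/c₊`, `Q = (Λ − b₊₊) − (c₊/c₋)(Λ − b₋₋)`. The leading slaving
coefficient of `…SonicCavityDefsB` is `ρ = slavingCoeff = b₊₋/Q = −β/q`, and the p-wave content observable is `D = p − ρ m`,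
i.e. `G := e^{−θ} D = w − ρ u`. This file proves:

* `levinson_slaved_gauge` (abstract, over `ℝ` or `ℂ`): if `u′ = α w`, `w′ = q w + β u`, `ρ′` exists and `q ρ + β = 0` at a point,
  then `G = w − ρ u` satisfies THE SLAVED-GAUGE EQUATION `G′ = (q − α ρ) G − (ρ′ + α ρ²) u` there — the `O(1)` coupling `β u`
  is traded for the `O(1/|Im Λ|)` forcing `(ρ′ + α ρ²) u` (one integration by parts, done on the equation);
* `slavingCoeff_mul_q` (`q ρ + β = 0` for the concrete coefficients where `c₊ c₋ Q ≠ 0`) and the concrete form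
  `pWaveContent_gauge_hasDerivAt` (registered helper): along a differentiable solution of the mode equations,
  `y ↦ e^{−θ y}((ŵ + 3ŝ) − ρ (ŵ − 3ŝ))(y)` has derivative `(q − α ρ) G − (ρ′ + α ρ²) u` at `x`;
* `slavingCoeff_sonic`, `pWave_slaved_at_sonic`: at the sonic point (`W 0 + S 0 = 1`, so `c₊(0) = 0`, `Q(0) = Λ − b₊₊(0)`)
  `ρ(0) = b₊₋(0)/(Λ − b₊₊(0))` and EVERY solution of the mode equations at `0` has `p(0) = ρ(0) m(0)` (`sonic_relation_char`):
  the p-wave content vanishes EXACTLY at the sonic point, for every `Λ ≠ b₊₊(0)`;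
* `abs_im_mul_norm_slavingCoeff_le`: on the core (`c₊ ≥ 0 > c₋`) `|Im Q| ≥ |Im Λ|`, hence `|Im Λ|·‖ρ‖ ≤ |b₊₋|`.

These are the exact identities every transport argument for `SonicSlaving` starts from (real-axis Levinson transport, or the
contour version of the worker report `work/stubs/W2_sonicSlaving.REPORT.md`). NOT here: any estimate along an interval.
Sources: Coppel 1965 Ch. IV; Eastham 1989 §1.3–1.4 (the second diagonalising transformation). No citation is load-bearing.
-/

noncomputable section

open Set

namespace Summit.AtomisticToContinuum.HydrodynamicLimit.Theorems.SonicCavityRenewal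

open Summit.AtomisticToContinuum.HydrodynamicLimit.Theorems.R2OneModeTwoConditions

/-! ## The abstract slaved gauge -/

/-- **THE SLAVED-GAUGE EQUATION** (abstract `2 × 2` triangular-interaction system, over `𝕜 = ℝ` or `ℂ`). If at the point `x`
`u′ = α w`, `w′ = q w + β u`, `ρ` has derivative `ρ′`, and `q ρ + β = 0` (i.e. `ρ = −β/q` is the leading slaving coefficient),
then `G = w − ρ u` has derivative `(q − α ρ) G − (ρ′ + α ρ²) u`: the coupling to the slow component drops from `β u = O(1)·u` to
`(ρ′ + α ρ²) u`. [folklore] -/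
theorem levinson_slaved_gauge {𝕜 : Type*} [NontriviallyNormedField 𝕜] [NormedAlgebra 𝕜 ℂ] {u w ρ : 𝕜 → ℂ} {x : 𝕜}
    {α β q ρ' : ℂ} (hu : HasDerivAt u (α * w x) x) (hw : HasDerivAt w (q * w x + β * u x) x) (hρ : HasDerivAt ρ ρ' x)
    (hslave : q * ρ x + β = 0) :
    HasDerivAt (fun y => w y - ρ y * u y) ((q - α * ρ x) * (w x - ρ x * u x) - (ρ' + α * ρ x ^ 2) * u x) x := by
  refine (hw.sub (hρ.mul hu)).congr_deriv ?_
  linear_combination (u x) * hslave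

/-! ## The concrete coefficients -/

/-- `q = Q / c₊`: `(Λ − b₊₊)/c₊ − (Λ − b₋₋)/c₋ = ((Λ − b₊₊) − (c₊/c₋)(Λ − b₋₋))/c₊` where `c₊ c₋ ≠ 0` (the real ratio `c₊/c₋` cast to
`ℂ`, as in `slavingCoeff`). [folklore] -/
theorem levinson_q_eq_div {r : ℝ} {W S : ℝ → ℝ} {Λ : ℂ} {x : ℝ} (hp : W x - 1 + S x ≠ 0) (hm : W x - 1 - S x ≠ 0) :
    (Λ - ((2 / 3 * deriv W x + 2 * W x - r + 2 * deriv S x + 4 * S x : ℝ) : ℂ)) / ((W x - 1 + S x : ℝ) : ℂ) -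
        (Λ - ((2 / 3 * deriv W x + 2 * W x - r - 2 * deriv S x - 4 * S x : ℝ) : ℂ)) / ((W x - 1 - S x : ℝ) : ℂ) =
      ((Λ - ((2 / 3 * deriv W x + 2 * W x - r + 2 * deriv S x + 4 * S x : ℝ) : ℂ)) -
          (((W x - 1 + S x) / (W x - 1 - S x) : ℝ) : ℂ) *
            (Λ - ((2 / 3 * deriv W x + 2 * W x - r - 2 * deriv S x - 4 * S x : ℝ) : ℂ))) /
        ((W x - 1 + S x : ℝ) : ℂ) := by
  have hp' : ((W x - 1 + S x : ℝ) : ℂ) ≠ 0 := Complex.ofReal_ne_zero.2 hp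
  have hm' : ((W x - 1 - S x : ℝ) : ℂ) ≠ 0 := Complex.ofReal_ne_zero.2 hm
  rw [Complex.ofReal_div]
  field_simp

/-- `q ρ + β = 0` for the concrete coefficients: with `ρ = slavingCoeff = b₊₋/Q`, `q = Q/c₊`, `β = −b₊₋/c₊`, wherever
`c₊ c₋ Q ≠ 0`. [folklore] -/
theorem slavingCoeff_mul_q {r : ℝ} {W S : ℝ → ℝ} {Λ : ℂ} {x : ℝ} (hp : W x - 1 + S x ≠ 0) (hm : W x - 1 - S x ≠ 0)
    (hQ : (Λ - ((2 / 3 * deriv W x + 2 * W x - r + 2 * deriv S x + 4 * S x : ℝ) : ℂ)) -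
        (((W x - 1 + S x) / (W x - 1 - S x) : ℝ) : ℂ) *
          (Λ - ((2 / 3 * deriv W x + 2 * W x - r - 2 * deriv S x - 4 * S x : ℝ) : ℂ)) ≠ 0) :
    ((Λ - ((2 / 3 * deriv W x + 2 * W x - r + 2 * deriv S x + 4 * S x : ℝ) : ℂ)) / ((W x - 1 + S x : ℝ) : ℂ) -
          (Λ - ((2 / 3 * deriv W x + 2 * W x - r - 2 * deriv S x - 4 * S x : ℝ) : ℂ)) / ((W x - 1 - S x : ℝ) : ℂ)) *
        slavingCoeff r W S Λ x +
      -((deriv W x / 3 + deriv S x + 2 * S x : ℝ) : ℂ) / ((W x - 1 + S x : ℝ) : ℂ) = 0 := by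
  rw [levinson_q_eq_div hp hm]
  have hρ : slavingCoeff r W S Λ x = ((deriv W x / 3 + deriv S x + 2 * S x : ℝ) : ℂ) /
      ((Λ - ((2 / 3 * deriv W x + 2 * W x - r + 2 * deriv S x + 4 * S x : ℝ) : ℂ)) -
        (((W x - 1 + S x) / (W x - 1 - S x) : ℝ) : ℂ) *
          (Λ - ((2 / 3 * deriv W x + 2 * W x - r - 2 * deriv S x - 4 * S x : ℝ) : ℂ))) := rfl
  rw [hρ, div_mul_div_comm, mul_comm _ (((deriv W x / 3 + deriv S x + 2 * S x : ℝ) : ℂ)), ← div_mul_div_comm,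
    div_self hQ, mul_one, neg_div, add_neg_cancel]

/-- **THE SLAVED GAUGE OF THE MODE SYSTEM** — registered helper `pWaveContent_gauge_hasDerivAt` for `sonicSlaving_of_tube`.
At a point `x` where both characteristic speeds and `Q = (Λ − b₊₊) − (c₊/c₋)(Λ − b₋₋)` are non-zero, for any local phase `θ` of the
`−` family (`θ′ = (Λ − b₋₋)/c₋` at `x`) and a solution `(ŵ, ŝ)` of the mode equations differentiable at `x`, the gauged p-wave
content `G = e^{−θ}((ŵ + 3ŝ) − ρ (ŵ − 3ŝ))`, `ρ = slavingCoeff r W S Λ` (with derivative `ρ′` at `x`), satisfies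
`G′ = (q − α ρ) G − (ρ′ + α ρ²) u`, `u = e^{−θ}(ŵ − 3ŝ)`, `q = (Λ − b₊₊)/c₊ − (Λ − b₋₋)/c₋`, `α = −b₋₊/c₋`. At `x = matchPoint` and
`θ(matchPoint) = 0` the gauged content IS `pWaveContent`. [folklore] -/
theorem pWaveContent_gauge_hasDerivAt : ∀ (r : ℝ) (W S : ℝ → ℝ) (Λ : ℂ) (ŵ ŝ θ : ℝ → ℂ) (ρ' : ℂ) (x : ℝ), DifferentiableAt ℝ ŵ x → DifferentiableAt ℝ ŝ x → (Λ * ŵ x = linW r W S ŵ ŝ x ∧ Λ * ŝ x = linS r W S ŵ ŝ x) → W x - 1 + S x ≠ 0 → W x - 1 - S x ≠ 0 → (Λ - ((2 / 3 * deriv W x + 2 * W x - r + 2 * deriv S x + 4 * S x : ℝ) : ℂ)) - (((W x - 1 + S x) / (W x - 1 - S x) : ℝ) : ℂ) * (Λ - ((2 / 3 * deriv W x + 2 * W x - r - 2 * deriv S x - 4 * S x : ℝ) : ℂ)) ≠ 0 → HasDerivAt θ ((Λ - ((2 / 3 * deriv W x + 2 * W x - r - 2 * deriv S x - 4 * S x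 : ℝ) : ℂ)) / ((W x - 1 - S x : ℝ) : ℂ)) x → HasDerivAt (slavingCoeff r W S Λ) ρ' x → HasDerivAt (fun y => Complex.exp (-θ y) * ((ŵ y + 3 * ŝ y) - slavingCoeff r W S Λ y * (ŵ y - 3 * ŝ y))) ((((Λ - ((2 / 3 * deriv W x + 2 * W x - r + 2 * deriv S x + 4 * S x : ℝ) : ℂ)) / ((W x - 1 + S x : ℝ) : ℂ) - (Λ - ((2 / 3 * deriv W x + 2 * W x - r - 2 * deriv S x - 4 * S x : ℝ) : ℂ)) / ((W x - 1 - S x : ℝ) : ℂ)) - (-((deriv W x / 3 - deriv S x - 2 * S x : ℝ) : ℂ) / ((W x - 1 - S x : ℝ) : ℂ)) * slavingCoeff r W S Λ x) * (Complex.exp (-θ x) * ((ŵ x + 3 * ŝ x) - slavingCoeff r W S Λ x * (ŵ x - 3 * ŝ x))) - (ρ' + (-((deriv W x / 3 - deriv S x - 2 * S x : ℝ) : ℂ) / ((W x - 1 - S x : ℝ) : ℂ)) * slavingCoeff r W S Λ x ^ 2) * (Complex.exp (-θ x) * (ŵ x - 3 * ŝ x))) x := by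
  intro r W S Λ ŵ ŝ θ ρ' x hŵ hŝ h hp hm hQ hθ hρ
  obtain ⟨hu, hw⟩ := mode_levinson_form r W S Λ ŵ ŝ θ x hŵ hŝ h hp hm hθ
  have key := levinson_slaved_gauge (𝕜 := ℝ) (u := fun y => Complex.exp (-θ y) * (ŵ y - 3 * ŝ y))
    (w := fun y => Complex.exp (-θ y) * (ŵ y + 3 * ŝ y)) (ρ := slavingCoeff r W S Λ) (x := x) hu hw hρ
    (slavingCoeff_mul_q hp hm hQ)
  have hfun : (fun y => Complex.exp (-θ y) * ((ŵ y + 3 * ŝ y) - slavingCoeff r W S Λ y * (ŵ y - 3 * ŝ y))) =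
      fun y => Complex.exp (-θ y) * (ŵ y + 3 * ŝ y) - slavingCoeff r W S Λ y * (Complex.exp (-θ y) * (ŵ y - 3 * ŝ y)) :=
    funext fun y => by ring
  rw [hfun]
  refine key.congr_deriv ?_
  ring

/-- The gauged content at the matching point with `θ(x_m) = 0` is the p-wave content observable of `…SonicCavityDefsB`. [folklore] -/
theorem pWaveContent_eq_gauge {r : ℝ} {W S : ℝ → ℝ} {Λ : ℂ} {ŵ ŝ θ : ℝ → ℂ} (hθ : θ matchPoint = 0) :
    pWaveContent r W S Λ ŵ ŝ =
      Complex.exp (-θ matchPoint) *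
        ((ŵ matchPoint + 3 * ŝ matchPoint) - slavingCoeff r W S Λ matchPoint * (ŵ matchPoint - 3 * ŝ matchPoint)) := by
  rw [hθ, neg_zero, Complex.exp_zero, one_mul]
  rfl

/-! ## The sonic point: the p-wave content vanishes exactly -/

/-- At the sonic point (`W 0 + S 0 = 1`, so `c₊(0) = 0` and `Q(0) = Λ − b₊₊(0)`) the slaving coefficient is
`ρ(0) = b₊₋(0)/(Λ − b₊₊(0))`. [folklore] -/
theorem slavingCoeff_sonic {r : ℝ} {W S : ℝ → ℝ} {Λ : ℂ} (h0 : W 0 + S 0 = 1) :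
    slavingCoeff r W S Λ 0 =
      ((deriv W 0 / 3 + deriv S 0 + 2 * S 0 : ℝ) : ℂ) /
        (Λ - ((2 / 3 * deriv W 0 + 2 * W 0 - r + 2 * deriv S 0 + 4 * S 0 : ℝ) : ℂ)) := by
  have hc : W 0 - 1 + S 0 = 0 := by linarith
  show ((deriv W 0 / 3 + deriv S 0 + 2 * S 0 : ℝ) : ℂ) /
      ((Λ - ((2 / 3 * deriv W 0 + 2 * W 0 - r + 2 * deriv S 0 + 4 * S 0 : ℝ) : ℂ)) -
        (((W 0 - 1 + S 0) / (W 0 - 1 - S 0) : ℝ) : ℂ) *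
          (Λ - ((2 / 3 * deriv W 0 + 2 * W 0 - r - 2 * deriv S 0 - 4 * S 0 : ℝ) : ℂ))) = _
  rw [hc, zero_div, Complex.ofReal_zero, zero_mul, sub_zero]

/-- **THE P-WAVE CONTENT VANISHES AT THE SONIC POINT.** For every solution of the mode equations at `x = 0` of a profile with
`W 0 + S 0 = 1` and every `Λ ≠ b₊₊(0)` (e.g. `Im Λ ≠ 0`): `(ŵ 0 + 3ŝ 0) − ρ(0)(ŵ 0 − 3ŝ 0) = 0` — the sonic relation
`(Λ − b₊₊(0)) p(0) = b₊₋(0) m(0)` (`sonic_relation_char`) divided by `Λ − b₊₊(0)`. No smoothness beyond the equations AT `0` is used: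
the degenerate component is exactly slaved at the sonic point for every `C¹` solution. [folklore] -/
theorem pWave_slaved_at_sonic {r : ℝ} {W S : ℝ → ℝ} {Λ : ℂ} {ŵ ŝ : ℝ → ℂ} (h0 : W 0 + S 0 = 1)
    (hΛ : Λ ≠ ((2 / 3 * deriv W 0 + 2 * W 0 - r + 2 * deriv S 0 + 4 * S 0 : ℝ) : ℂ))
    (h : Λ * ŵ 0 = linW r W S ŵ ŝ 0 ∧ Λ * ŝ 0 = linS r W S ŵ ŝ 0) :
    (ŵ 0 + 3 * ŝ 0) - slavingCoeff r W S Λ 0 * (ŵ 0 - 3 * ŝ 0) = 0 := by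
  rw [slavingCoeff_sonic h0]
  have key := sonic_relation_char h0 h
  have hne : Λ - ((2 / 3 * deriv W 0 + 2 * W 0 - r + 2 * deriv S 0 + 4 * S 0 : ℝ) : ℂ) ≠ 0 := sub_ne_zero.2 hΛ
  rw [div_mul_eq_mul_div, sub_eq_zero, eq_div_iff hne]
  linear_combination key

/-- `Im Λ ≠ 0` excludes `Λ = b₊₊(0)` (a real number), the hypothesis of `pWave_slaved_at_sonic`. [folklore] -/
theorem ne_bpp_of_im_ne_zero {r : ℝ} {W S : ℝ → ℝ} {Λ : ℂ} (hΛ : Λ.im ≠ 0) (x : ℝ) :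
    Λ ≠ ((2 / 3 * deriv W x + 2 * W x - r + 2 * deriv S x + 4 * S x : ℝ) : ℂ) := by
  intro h
  apply hΛ
  rw [h, Complex.ofReal_im]

/-! ## Size of the slaving coefficient on the core -/

/-- On the core side of the sonic point (`c₊ = W − 1 + S ≥ 0`, `c₋ = W − 1 − S < 0`) the imaginary part of
`Q = (Λ − b₊₊) − (c₊/c₋)(Λ − b₋₋)` is `Im Λ·(1 − c₊/c₋)` with `1 − c₊/c₋ ≥ 1`, so `|Im Λ| ≤ ‖Q‖`. [folklore] -/
theorem abs_im_le_norm_Q {r : ℝ} {W S : ℝ → ℝ} {Λ : ℂ} {x : ℝ} (hp : 0 ≤ W x - 1 + S x) (hm : W x - 1 - S x < 0) :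
    |Λ.im| ≤ ‖(Λ - ((2 / 3 * deriv W x + 2 * W x - r + 2 * deriv S x + 4 * S x : ℝ) : ℂ)) -
        (((W x - 1 + S x) / (W x - 1 - S x) : ℝ) : ℂ) *
          (Λ - ((2 / 3 * deriv W x + 2 * W x - r - 2 * deriv S x - 4 * S x : ℝ) : ℂ))‖ := by
  set Qc : ℂ := (Λ - ((2 / 3 * deriv W x + 2 * W x - r + 2 * deriv S x + 4 * S x : ℝ) : ℂ)) -
        (((W x - 1 + S x) / (W x - 1 - S x) : ℝ) : ℂ) *
          (Λ - ((2 / 3 * deriv W x + 2 * W x - r - 2 * deriv S x - 4 * S x : ℝ) : ℂ)) with hQc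
  have hratio : (W x - 1 + S x) / (W x - 1 - S x) ≤ 0 := div_nonpos_of_nonneg_of_nonpos hp hm.le
  have him : Qc.im = Λ.im * (1 - (W x - 1 + S x) / (W x - 1 - S x)) := by
    simp only [hQc, Complex.sub_im, Complex.mul_im, Complex.ofReal_im, Complex.ofReal_re]
    ring
  calc |Λ.im| ≤ |Λ.im| * (1 - (W x - 1 + S x) / (W x - 1 - S x)) :=
        le_mul_of_one_le_right (abs_nonneg _) (by linarith)
    _ = |Qc.im| := by rw [him, abs_mul, abs_of_pos (by linarith : 0 < 1 - (W x - 1 + S x) / (W x - 1 - S x))]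
    _ ≤ ‖Qc‖ := Complex.abs_im_le_norm Qc

/-- **SIZE OF THE SLAVING COEFFICIENT ON THE CORE**: where `c₊ ≥ 0 > c₋`, `|Im Λ|·‖slavingCoeff r W S Λ x‖ ≤ |b₊₋(x)|`
(`ρ = b₊₋/Q`, `‖Q‖ ≥ |Im Λ|`). With the tube envelope (c) this is `O(1/|Im Λ|)` uniformly on `x ≤ 0`. [folklore] -/
theorem abs_im_mul_norm_slavingCoeff_le {r : ℝ} {W S : ℝ → ℝ} {Λ : ℂ} {x : ℝ} (hp : 0 ≤ W x - 1 + S x)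
    (hm : W x - 1 - S x < 0) :
    |Λ.im| * ‖slavingCoeff r W S Λ x‖ ≤ |deriv W x / 3 + deriv S x + 2 * S x| := by
  have hQ := abs_im_le_norm_Q (r := r) (Λ := Λ) hp hm
  set Qc : ℂ := (Λ - ((2 / 3 * deriv W x + 2 * W x - r + 2 * deriv S x + 4 * S x : ℝ) : ℂ)) -
        (((W x - 1 + S x) / (W x - 1 - S x) : ℝ) : ℂ) *
          (Λ - ((2 / 3 * deriv W x + 2 * W x - r - 2 * deriv S x - 4 * S x : ℝ) : ℂ)) with hQc
  have hρ : slavingCoeff r W S Λ x = ((deriv W x / 3 + deriv S x + 2 * S x : ℝ) : ℂ) / Qc := rfl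
  rw [hρ, norm_div, Complex.norm_real, Real.norm_eq_abs]
  by_cases hQ0 : Qc = 0
  · rw [hQ0, norm_zero, div_zero, mul_zero]
    exact abs_nonneg _
  · have hQpos : 0 < ‖Qc‖ := norm_pos_iff.2 hQ0
    rw [mul_div_assoc']
    rw [div_le_iff₀ hQpos]
    calc |Λ.im| * |deriv W x / 3 + deriv S x + 2 * S x| ≤ ‖Qc‖ * |deriv W x / 3 + deriv S x + 2 * S x| :=
          mul_le_mul_of_nonneg_right hQ (abs_nonneg _)
      _ = |deriv W x / 3 + deriv S x + 2 * S x| * ‖Qc‖ := mul_comm _ _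

end Summit.AtomisticToContinuum.HydrodynamicLimit.Theorems.SonicCavityRenewal

end
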